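import Summits.Schanuel.Schanuel.Theorems.ZilberEacMovingPolydiscCentres
import HarnessLib

/-!
# Existence in the INVARIANT-DIRECTION regime: solutions near every shifted lattice ray

Zilber's Exponential-Algebraic Closedness, case ladder (host summit Schanuel, cell `pub-schanuel`,
seat 2, gen 11).  The `(s+1)`-folds `W = polyFibredGraph g A F = {x_s = g(x), yⱼ = Aⱼ(x) + y_s fⱼ(y_s)}`
over a graph base have exponential points = solutions of `e^{xⱼ} = Aⱼ(x) + e^{g(x)} fⱼ(e^{g(x)})`.
Gen 10 (THEOREM K + the several-variable exp–exp balance) settled every base of degree `≥ 2` in a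
NON-DEGENERATE balance direction `g_D(e) ≠ 0`; O51 (b) named the degenerate directions, whose model
is `x₂ = -(x₀ - x₁)²` with equal fibre degrees: no negative ray, no oscillatory ray, `g_D(1,1) = 0`.

The mechanism here is different from all earlier regimes.  Suppose `g` is INVARIANT under the
lattice direction `q ∈ ℤˢ`: `g(x + z q) = g(x)` for all `z ∈ ℂ` (so `g = -(x₀ - x₁)²` with
`q = (1,1)`), the leading forms of the `Aⱼ` do not vanish at `v = 2πi q`, and the degrees
`dⱼ = deg Aⱼ ≥ 1` are proportional to `q` (`dⱼ = λ qⱼ`).  Along the shifted lattice ray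
`2πi(m q + p)` (`p ∈ ℤˢ` a LABEL) the moving lattice centres are
`c(m) = (2πi m + λ log m) q + (2πi p + log a + o(1))` (`aⱼ = (Aⱼ)_{dⱼ}(v)`), and by invariance
`g(c(m) + ξ) = g(2πi p + log a + o(1) + ξ)` is BOUNDED on the unit polydiscs: the coupling
`e^{g} fⱼ(e^{g})` is a bounded — hence relatively small — perturbation of the moving-lattice problem
`e^{xⱼ} = Aⱼ(x)`.  **THEOREM (`exists_solutions_invariantDirection`).**  For every label `p` there are
solutions `x(m) = r(m) + (2πi m + λ log m) q` for all large `m` with TRANSVERSAL LIMIT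
`r(m) → r_p = 2πi p + log a` and `g(x(m)) = g(r(m)) → g(r_p)`: the power coordinate
`w = e^{g(x)}` stays bounded and converges along each family — the input format of THEOREM L
(`ZilberEacTransversalLimits`); the density theorem is `ZilberEacInvariantDirectionDensity`.

Ingredients: `exists_exp_eq_poly_add_near_centre` (centres with the continuous logarithm branch
`ℓⱼ(m) = dⱼ log m + log aⱼ + log(Aⱼ(m v)/(m^{dⱼ} aⱼ))`), `exists_seq_of_forall_eventually_exists_near`.

HONEST FRAMING: an existence theorem for explicit families inside an OPEN cell; `EC(3,2)` OPEN;
NOT Schanuel's conjecture; EAC ⇏ SC.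
-/

noncomputable section

open Complex MvPolynomial Metric Set Filter Topology

set_option linter.dupNamespace false

namespace Summit.Schanuel.Schanuel.Theorems

section InvariantDirection

variable {s : ℕ}

/-- `Aⱼ(m v) / (m^{d} (A)_d(v)) → 1` when the leading form does not vanish at `v`. [folklore] -/
theorem tendsto_latticeValue_div (A : MvPolynomial (Fin s) ℂ) (v : Fin s → ℂ)
    (hA : eval v (homogeneousComponent A.totalDegree A) ≠ 0) :
    Tendsto (fun m : ℕ => eval (fun i => (m : ℂ) * v i) A /
      ((m : ℂ) ^ A.totalDegree * eval v (homogeneousComponent A.totalDegree A))) atTop (𝓝 1) := by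
  have ha : 0 < ‖eval v (homogeneousComponent A.totalDegree A)‖ := norm_pos_iff.2 hA
  refine Metric.tendsto_nhds.2 fun ε hε => ?_
  obtain ⟨ρ, hρ, t₀, ht₀, h⟩ := eval_near_natMul_add A v
    (ε := ε / 2 * ‖eval v (homogeneousComponent A.totalDegree A)‖) (by positivity)
  filter_upwards [tendsto_natCast_atTop_atTop.eventually_ge_atTop t₀] with m hm
  have hm0 : (0 : ℝ) < m := by linarith
  have h0 := h m hm 0 (by rw [norm_zero]; positivity)
  rw [add_zero] at h0
  have hmd : (0 : ℝ) < (m : ℝ) ^ A.totalDegree := pow_pos hm0 _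
  have hden : (m : ℂ) ^ A.totalDegree * eval v (homogeneousComponent A.totalDegree A) ≠ 0 :=
    mul_ne_zero (pow_ne_zero _ (by exact_mod_cast hm0.ne')) hA
  rw [dist_eq_norm, div_sub_one hden, norm_div, norm_mul, norm_pow, Complex.norm_natCast,
    div_lt_iff₀ (by positivity)]
  calc ‖eval (fun i => (m : ℂ) * v i) A -
        (m : ℂ) ^ A.totalDegree * eval v (homogeneousComponent A.totalDegree A)‖
      ≤ ε / 2 * ‖eval v (homogeneousComponent A.totalDegree A)‖ * (m : ℝ) ^ A.totalDegree := h0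
    _ = ε * ((m : ℝ) ^ A.totalDegree * ‖eval v (homogeneousComponent A.totalDegree A)‖) / 2 := by
        ring
    _ < ε * ((m : ℝ) ^ A.totalDegree * ‖eval v (homogeneousComponent A.totalDegree A)‖) := by
        linarith [mul_pos hε (mul_pos hmd ha)]

/-- `exp (2πi p) = 1` for an integer `p`, in the cell's normal form. [folklore] -/
theorem exp_two_pi_I_mul_intCast (p : ℤ) : exp (2 * Real.pi * I * (p : ℂ)) = 1 := by
  rw [show (2 * Real.pi * I * (p : ℂ) : ℂ) = p * (2 * Real.pi * I) by ring]
  exact Complex.exp_int_mul_two_pi_mul_I p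

/-- `‖2πi m + λ log m‖ → ∞` (its imaginary part is `2π m`). [folklore] -/
theorem tendsto_norm_two_pi_I_mul_add_mul_log (lam : ℝ) :
    Tendsto (fun m : ℕ => ‖(2 * Real.pi * I * (m : ℂ) + (lam : ℂ) * log (m : ℂ))‖) atTop atTop := by
  refine tendsto_atTop_mono (fun m => ?_)
    (tendsto_natCast_atTop_atTop.const_mul_atTop Real.two_pi_pos)
  have him : (2 * Real.pi * I * (m : ℂ) + (lam : ℂ) * log (m : ℂ)).im = 2 * Real.pi * m := by
    rw [Complex.add_im, Complex.im_ofReal_mul, Complex.log_im, Complex.natCast_arg, mul_zero,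
      add_zero, show (2 * Real.pi * I * (m : ℂ) : ℂ) = ((2 * Real.pi * (m : ℝ) : ℝ) : ℂ) * I by
        push_cast; ring, Complex.im_ofReal_mul, Complex.I_im, mul_one]
  calc 2 * Real.pi * (m : ℝ) = |(2 * Real.pi * I * (m : ℂ) + (lam : ℂ) * log (m : ℂ)).im| := by
        rw [him, abs_of_nonneg (by positivity)]
    _ ≤ ‖2 * Real.pi * I * (m : ℂ) + (lam : ℂ) * log (m : ℂ)‖ := Complex.abs_im_le_norm _

/-- **THEOREM (existence in the invariant-direction regime).**  See the module docstring.  For every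
label `p ∈ ℤˢ` there are solutions `x(m)` of `e^{xⱼ} = Aⱼ(x) + e^{g(x)} fⱼ(e^{g(x)})` (all large `m`)
of the form `x(m) = r(m) + (2πi m + λ log m) q` with `r(m) → 2πi p + log a`, `g(x(m)) = g(r(m))`,
and `‖2πi m + λ log m‖ → ∞`. (new)
[cite: MantovaMasser2023, §1 p.5 (the open case dim π(V) = 2 in ℂ³×ℂˣ³)] -/
theorem exists_solutions_invariantDirection (g : MvPolynomial (Fin s) ℂ) (q : Fin s → ℤ)
    (hper : ∀ (x : Fin s → ℂ) (z : ℂ), eval (x + z • fun j => (q j : ℂ)) g = eval x g)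
    (A : Fin s → MvPolynomial (Fin s) ℂ)
    (hA : ∀ j, eval (fun i => 2 * Real.pi * I * (q i : ℂ))
      (homogeneousComponent (A j).totalDegree (A j)) ≠ 0)
    (lam : ℝ) (hlam : ∀ j, ((A j).totalDegree : ℝ) = lam * (q j : ℝ))
    (hdeg : ∀ j, 0 < (A j).totalDegree) (f : Fin s → Polynomial ℂ) (p : Fin s → ℤ) :
    ∃ (x r : ℕ → Fin s → ℂ),
      (∀ᶠ m : ℕ in atTop, ∀ j, exp (x m j) =
        eval (x m) (A j) + exp (eval (x m) g) * (f j).eval (exp (eval (x m) g))) ∧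
      (∀ m, x m = r m + (2 * Real.pi * I * (m : ℂ) + (lam : ℂ) * log (m : ℂ)) •
        fun j => (q j : ℂ)) ∧
      (∀ m, eval (x m) g = eval (r m) g) ∧
      Tendsto r atTop (𝓝 fun j => 2 * Real.pi * I * (p j : ℂ) +
        log (eval (fun i => 2 * Real.pi * I * (q i : ℂ))
          (homogeneousComponent (A j).totalDegree (A j)))) ∧
      Tendsto (fun m : ℕ => ‖(2 * Real.pi * I * (m : ℂ) + (lam : ℂ) * log (m : ℂ))‖)
        atTop atTop := by
  classical
  -- data: leading values `a`, the ratios `Aⱼ(m v)/(m^{dⱼ} aⱼ) → 1`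
  obtain ⟨a, ha⟩ : ∃ a : Fin s → ℂ, a = fun j => eval (fun i => 2 * Real.pi * I * (q i : ℂ))
    (homogeneousComponent (A j).totalDegree (A j)) := ⟨_, rfl⟩
  have ha0 : ∀ j, a j ≠ 0 := fun j => by rw [ha]; exact hA j
  have hdC : ∀ j, (((A j).totalDegree : ℕ) : ℂ) = (lam : ℂ) * (q j : ℂ) := by
    intro j
    have h := congrArg (fun r : ℝ => (r : ℂ)) (hlam j)
    push_cast at h
    exact h
  obtain ⟨ratio, hratio⟩ : ∃ ratio : Fin s → ℕ → ℂ, ratio = fun j (m : ℕ) =>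
    eval (fun i => (m : ℂ) * (2 * Real.pi * I * (q i : ℂ))) (A j) /
      ((m : ℂ) ^ (A j).totalDegree * a j) := ⟨_, rfl⟩
  have hratio1 : ∀ j, Tendsto (ratio j) atTop (𝓝 1) := by
    intro j
    rw [hratio, ha]
    exact tendsto_latticeValue_div (A j) _ (hA j)
  have hlogratio : ∀ j, Tendsto (fun m => log (ratio j m)) atTop (𝓝 0) := by
    intro j
    have h := (hratio1 j).clog Complex.one_mem_slitPlane
    rwa [Complex.log_one] at h
  have hratio_ne : ∀ᶠ m : ℕ in atTop, ∀ j, ratio j m ≠ 0 :=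
    eventually_all.2 fun j => (hratio1 j).eventually (isOpen_ne.mem_nhds one_ne_zero)
  -- the logarithm branch, the escape parameter `y(m)`, the transversal part `rc(m)`, the centres
  obtain ⟨ℓ, hℓ⟩ : ∃ ℓ : ℕ → Fin s → ℂ, ℓ = fun (m : ℕ) j =>
    (((A j).totalDegree : ℕ) : ℂ) * log (m : ℂ) + log (a j) + log (ratio j m) := ⟨_, rfl⟩
  obtain ⟨y, hy⟩ : ∃ y : ℕ → ℂ,
    y = fun (m : ℕ) => 2 * Real.pi * I * (m : ℂ) + (lam : ℂ) * log (m : ℂ) := ⟨_, rfl⟩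
  obtain ⟨rc, hrc⟩ : ∃ rc : ℕ → Fin s → ℂ,
    rc = fun (m : ℕ) j => 2 * Real.pi * I * (p j : ℂ) + log (a j) + log (ratio j m) := ⟨_, rfl⟩
  obtain ⟨c, hc⟩ : ∃ c : ℕ → Fin s → ℂ, c = fun m => rc m + y m • fun j => (q j : ℂ) := ⟨_, rfl⟩
  have hc' : ∀ m j, c m j = (m : ℂ) * (2 * Real.pi * I * (q j : ℂ)) +
      (2 * Real.pi * I * (p j : ℂ) + ℓ m j) := by
    intro m j
    simp only [hc, hrc, hy, hℓ, Pi.add_apply, Pi.smul_apply, smul_eq_mul]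
    rw [hdC j]
    ring
  -- the transversal part of the centres converges and is eventually bounded
  have hrc_lim : Tendsto rc atTop (𝓝 fun j => 2 * Real.pi * I * (p j : ℂ) + log (a j)) := by
    rw [hrc]
    refine tendsto_pi_nhds.2 fun j => ?_
    have h := (hlogratio j).const_add (2 * Real.pi * I * (p j : ℂ) + log (a j))
    rwa [add_zero] at h
  have hrc_bdd : ∀ᶠ m : ℕ in atTop,
      ‖rc m‖ ≤ ‖fun j => 2 * Real.pi * I * (p j : ℂ) + log (a j)‖ + 1 := by
    have h := hrc_lim
    rw [tendsto_iff_norm_sub_tendsto_zero] at h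
    filter_upwards [h.eventually (gt_mem_nhds zero_lt_one)] with m hm
    have := norm_le_norm_add_norm_sub' (rc m) (fun j => 2 * Real.pi * I * (p j : ℂ) + log (a j))
    linarith [hm.le]
  -- (C1) `exp c(m)ⱼ = Aⱼ(m v)` eventually
  have hcexp : ∀ᶠ m : ℕ in atTop, ∀ j,
      exp (c m j) = eval (fun k => (m : ℂ) * (2 * Real.pi * I * (q k : ℂ))) (A j) := by
    filter_upwards [hratio_ne, eventually_ge_atTop 1] with m hm hm1 j
    have hmC : (m : ℂ) ≠ 0 := by exact_mod_cast (show m ≠ 0 by omega)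
    rw [hc', Complex.exp_add, exp_natCast_mul_twoPiI_mul_intCast, one_mul, Complex.exp_add,
      exp_two_pi_I_mul_intCast, one_mul, hℓ]
    dsimp only
    rw [Complex.exp_add, Complex.exp_add, Complex.exp_log (ha0 j), Complex.exp_log (hm j),
      Complex.exp_nat_mul, Complex.exp_log hmC, hratio]
    dsimp only
    have hden : (m : ℂ) ^ (A j).totalDegree * a j ≠ 0 := mul_ne_zero (pow_ne_zero _ hmC) (ha0 j)
    rw [mul_div_assoc', mul_comm ((m : ℂ) ^ (A j).totalDegree * a j), mul_div_assoc,
      div_self hden, mul_one]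
  -- (C2) `‖c(m) - m v‖ = O(log m)`
  have hcsmall : ∀ δ : ℝ, 0 < δ → ∀ᶠ m : ℕ in atTop,
      ‖c m - fun i => (m : ℂ) * (2 * Real.pi * I * (q i : ℂ))‖ + 1 ≤ δ * m := by
    intro δ hδ
    set K : ℝ := ∑ j, (‖(2 * Real.pi * I * (p j : ℂ) : ℂ)‖ + ‖log (a j)‖) + 2 with hK
    set D : ℝ := ∑ j, ((A j).totalDegree : ℝ) with hD
    have hlog1 : ∀ j, ∀ᶠ m : ℕ in atTop, ‖log (ratio j m)‖ ≤ 1 := by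
      intro j
      have h := (hlogratio j)
      rw [tendsto_zero_iff_norm_tendsto_zero] at h
      filter_upwards [h.eventually (gt_mem_nhds zero_lt_one)] with m hm
      exact hm.le
    filter_upwards [eventually_all.2 hlog1, eventually_mul_log_add_le D K hδ, eventually_ge_atTop 1]
      with m hm hmδ hm1
    have hlogm : 0 ≤ Real.log m := Real.log_nonneg (by exact_mod_cast hm1)
    have hnlog : ‖log (m : ℂ)‖ = Real.log m := by
      rw [← Complex.natCast_log, Complex.norm_real, Real.norm_eq_abs, abs_of_nonneg hlogm]
    have hcomp : ∀ j, ‖(c m - fun i => (m : ℂ) * (2 * Real.pi * I * (q i : ℂ))) j‖ ≤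
        D * Real.log m + (K - 1) := by
      intro j
      have e : (c m - fun i => (m : ℂ) * (2 * Real.pi * I * (q i : ℂ))) j =
          2 * Real.pi * I * (p j : ℂ) + ℓ m j := by
        rw [Pi.sub_apply, hc']; ring
      rw [e, hℓ]
      dsimp only
      have hdj : ((A j).totalDegree : ℝ) ≤ D :=
        Finset.single_le_sum (f := fun j => ((A j).totalDegree : ℝ)) (fun _ _ => by positivity)
          (Finset.mem_univ j)
      have hKj : ‖(2 * Real.pi * I * (p j : ℂ) : ℂ)‖ + ‖log (a j)‖ ≤ K - 2 := by
        have := Finset.single_le_sum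
          (f := fun j => ‖(2 * Real.pi * I * (p j : ℂ) : ℂ)‖ + ‖log (a j)‖)
          (fun _ _ => by positivity) (Finset.mem_univ j)
        rw [hK]; linarith
      have hn1 : ‖(((A j).totalDegree : ℕ) : ℂ) * log (m : ℂ)‖ = (A j).totalDegree * Real.log m := by
        rw [norm_mul, Complex.norm_natCast, hnlog]
      have h3 := norm_add₃_le (a := (((A j).totalDegree : ℕ) : ℂ) * log (m : ℂ)) (b := log (a j))
        (c := log (ratio j m))
      calc ‖2 * Real.pi * I * (p j : ℂ) +
            ((((A j).totalDegree : ℕ) : ℂ) * log (m : ℂ) + log (a j) + log (ratio j m))‖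
          ≤ ‖(2 * Real.pi * I * (p j : ℂ) : ℂ)‖ +
            ‖(((A j).totalDegree : ℕ) : ℂ) * log (m : ℂ) + log (a j) + log (ratio j m)‖ :=
            norm_add_le _ _
        _ ≤ ‖(2 * Real.pi * I * (p j : ℂ) : ℂ)‖ +
            (‖(((A j).totalDegree : ℕ) : ℂ) * log (m : ℂ)‖ + ‖log (a j)‖ + ‖log (ratio j m)‖) := by
            linarith
        _ ≤ D * Real.log m + (K - 1) := by
            rw [hn1]
            nlinarith [hm j, hdj, hKj, hlogm]
    have hD0 : 0 ≤ D := by rw [hD]; exact Finset.sum_nonneg fun j _ => Nat.cast_nonneg _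
    have hK2 : 2 ≤ K := by
      rw [hK]
      have := Finset.sum_nonneg fun j (_ : j ∈ (Finset.univ : Finset (Fin s))) =>
        (show 0 ≤ ‖(2 * Real.pi * I * (p j : ℂ) : ℂ)‖ + ‖log (a j)‖ by positivity)
      linarith
    have hnn : 0 ≤ D * Real.log m + (K - 1) := by
      have := mul_nonneg hD0 hlogm
      linarith
    have hnorm : ‖c m - fun i => (m : ℂ) * (2 * Real.pi * I * (q i : ℂ))‖ ≤
        D * Real.log m + (K - 1) :=
      (pi_norm_le_iff_of_nonneg hnn).2 hcomp
    linarith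
  -- the perturbation and its smallness
  obtain ⟨P, hP⟩ : ∃ P : ℕ → Fin s → (Fin s → ℂ) → ℂ,
    P = fun _ j x => exp (eval x g) * (f j).eval (exp (eval x g)) := ⟨_, rfl⟩
  have hPdiff : ∀ᶠ m : ℕ in atTop, ∀ j, DifferentiableOn ℂ (P m j) (ball (c m) 1) := by
    filter_upwards with m j
    rw [hP]
    have h1 : Differentiable ℂ fun x : Fin s → ℂ => exp (eval x g) :=
      (differentiable_mvPolynomial_eval g).cexp
    exact (h1.mul ((f j).differentiable.comp h1)).differentiableOn
  have hinv : ∀ m ξ, eval (c m + ξ) g = eval (rc m + ξ) g := by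
    intro m ξ
    rw [hc]
    dsimp only
    rw [show rc m + y m • (fun j => (q j : ℂ)) + ξ = (rc m + ξ) + y m • fun j => (q j : ℂ) by abel,
      hper]
  have hPsmall : ∀ j, ∀ θ : ℝ, 0 < θ → ∀ᶠ m : ℕ in atTop, ∀ ξ : Fin s → ℂ, ‖ξ‖ < 1 →
      ‖P m j (c m + ξ)‖ ≤ θ * (m : ℝ) ^ (A j).totalDegree := by
    intro j θ hθ
    obtain ⟨Cg, hCg, Ng, hg⟩ :=
      Literature.NumberTheory.Transcendental.HypersurfaceCover.exists_norm_eval_le_pow g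
    obtain ⟨Cf, hCf, Nf, hf⟩ := exists_norm_polynomial_eval_le_pow (f j)
    set R : ℝ := ‖fun j => 2 * Real.pi * I * (p j : ℂ) + log (a j)‖ + 1 with hR
    set M : ℝ := Cg * (1 + (R + 1)) ^ Ng with hM
    set Kc : ℝ := Real.exp M * (Cf * (1 + Real.exp M) ^ Nf) with hKc
    filter_upwards [hrc_bdd, (tendsto_natCast_atTop_atTop.const_mul_atTop hθ).eventually_ge_atTop Kc,
      eventually_ge_atTop 1] with m hm hmK hm1 ξ hξ
    have hm1' : (1 : ℝ) ≤ m := by exact_mod_cast hm1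
    rw [hP]
    dsimp only
    rw [hinv m ξ]
    have hR0 : 0 ≤ R := by positivity
    have hz : ‖rc m + ξ‖ ≤ R + 1 := (norm_add_le _ _).trans (by linarith [hξ.le])
    have hgb : ‖eval (rc m + ξ) g‖ ≤ M := (hg _).trans (by
      rw [hM]
      exact mul_le_mul_of_nonneg_left (pow_le_pow_left₀ (by positivity) (by linarith) _) hCg)
    have hexp : ‖exp (eval (rc m + ξ) g)‖ ≤ Real.exp M := by
      rw [Complex.norm_exp]
      exact Real.exp_le_exp.2 ((Complex.re_le_norm _).trans hgb)
    have hfb : ‖(f j).eval (exp (eval (rc m + ξ) g))‖ ≤ Cf * (1 + Real.exp M) ^ Nf :=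
      (hf _).trans (mul_le_mul_of_nonneg_left (pow_le_pow_left₀ (by positivity) (by linarith) _) hCf)
    calc ‖exp (eval (rc m + ξ) g) * (f j).eval (exp (eval (rc m + ξ) g))‖
        ≤ Real.exp M * (Cf * (1 + Real.exp M) ^ Nf) := by
          rw [norm_mul]; exact mul_le_mul hexp hfb (norm_nonneg _) (Real.exp_pos _).le
      _ = Kc := by rw [hKc]
      _ ≤ θ * m := hmK
      _ ≤ θ * (m : ℝ) ^ (A j).totalDegree := by
          refine mul_le_mul_of_nonneg_left ?_ hθ.le
          exact le_self_pow₀ hm1' (hdeg j).ne'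
  -- (C5) solutions near the centres, and a sequence with `x(m) - c(m) → 0`
  have hsol : ∀ ε : ℝ, 0 < ε → ∀ᶠ m : ℕ in atTop, ∃ x ∈ {x : Fin s → ℂ |
      ∀ j, exp (x j) = eval x (A j) + P m j x}, ‖x - c m‖ ≤ ε := by
    intro ε hε
    filter_upwards [exists_exp_eq_poly_add_near_centre q A hA c hcexp hcsmall P hPdiff hPsmall hε]
      with m hm
    obtain ⟨x, hx, hsol⟩ := hm
    exact ⟨x, hsol, hx⟩
  obtain ⟨x, hxS, hxc⟩ := exists_seq_of_forall_eventually_exists_near _ c hsol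
  refine ⟨x, fun m => x m - y m • fun j => (q j : ℂ), ?_, fun m => ?_, fun m => ?_, ?_,
    tendsto_norm_two_pi_I_mul_add_mul_log lam⟩
  · filter_upwards [hxS] with m hm j
    have h := hm j
    rw [hP] at h
    exact h
  · simp only [hy, sub_add_cancel]
  · have h := hper (x m - y m • fun j => (q j : ℂ)) (y m)
    rw [sub_add_cancel] at h
    dsimp only
    exact h
  · -- `r(m) = (x(m) - c(m)) + rc(m) → 0 + r_p`
    have he : (fun m => x m - y m • fun j => (q j : ℂ)) = fun m => (x m - c m) + rc m := by
      funext m; rw [hc]; dsimp only; abel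
    rw [he]
    simp only [ha] at hrc_lim
    have h := hxc.add hrc_lim
    rw [zero_add] at h
    exact h

end InvariantDirection

end Summit.Schanuel.Schanuel.Theorems
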